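import Summits.HodgeConjecture.HodgeConjecture.Theorems.Ring2AbelianAllAndreAnchorSplitPencils
import HarnessLib

/-!
# Ring 2 · AbelianAll — ANDRÉ AXIS, PART P-e: THE DICHOTOMY AT THE ODD ANCHORS — for `dim T` odd the weight-`m` polarized twisted square
  `(T × T, φ × (−φ))` is HYPERBOLIC IFF `m ∈ Nm(K_dˣ)`; the pencils through a threefold twisted-square chart with weight `m` are split at EVERY
  member if `m ∈ Nm(K_dˣ)` and non-split at EVERY member if `m ∉ Nm(K_dˣ)` (the parity law of parts O / P, final form)

HONEST FRAMING (page 1, verbatim): **research route, not a corollary; conditional on HC_CM plus one named minimal statement.** Cell line: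
research route conditional on HC_CM; not a corollary; Q11.4-sentence-2 already refuted in dim ≥ 3. `HC_CM`, `HC_AV`, the global nodes and every
named fact are ABSENT: fact-free, 0 `def`, 0 `sorry`. Seat `pub-hodge-ring2-ab-andre-2`, gen 46 (part P). Inputs: part O-a (class `[(−m)^g]`), part O-c §2
(non-split is constant along the pencil), part P-a §1 (polarized Landherr on `IsWeilType`), part P-d §2 (split class at a twisted-square chart ⟹ every member
hyperbolic), the tree's `VanGeemen1994` uniqueness of the discriminant class and (5.4.1) ⟹.

## Content (theorems only; standard axioms)

* §1 (AV level) **`twistedSquare_hyperbolic_iff_mem_norm_of_odd`** — `dim T = 2k + 1 ≥ 3`, `φ² = −d`: ONE embedding `e_T` and for every weight `m ≥ 1`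
  an embedding of `T × T` with `K`-symmetrised class `pr₁^*h_K + m·pr₂^*h_K` of van Geemen class `[−m]`, for which **`(T × T, φ × (−φ))` is hyperbolic
  IFF `m ∈ Nm(K_dˣ)`** (⟸ Landherr, part P-a §1; ⟹ van Geemen (5.4.1) + uniqueness: `[−m] = [−1] ⟺ m ∈ Nm`). With part P-a (even `dim T`: always
  hyperbolic) this is the parity law of the anchors in closed form.
* §2 (pencils, fact-free) **`weilPencil_dichotomy_of_oddTwistedSquareChart`** — compact abelian pencil with its `K`-action through a chart `K`-isogenous
  to `(T × T, φ_T × (−φ_T))`, `dim T = 2k + 1`, relative class restricting to `gT^*h` with `h` of class `[−m]`: if `m ∈ Nm(K_dˣ)` EVERY member is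
  hyperbolic for the relative class (part P-d §2); if `m ∉ Nm(K_dˣ)` NO member is (part O-c §2). For `k = 1` (`B × B̄`, `E³ × Ē³`): split W₆ pencils —
  closed modulo refereed print for `ℚ(i)`, `ℚ(√−3)` (part P-d §3) — versus the OPEN instance (part O-c §4), through the same anchor.

## Honest status

Bookkeeping with kernel content: nothing here is a case of the Hodge conjecture or of `B(X)`; the open instance is untouched; nothing minimal
claimed; N104 untouched. EDGE LABELS: all K (fact-free). References: vanGeemen1994HodgeAV (4.14, Lemma 5.2 (3), 5.3–5.4, (5.4.1));
Landherr1936HermitianForms; Markman2025SurveySecant (§11.5 Step 1: «if and only if»); Andre1996Motifs (§6.3).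
-/

noncomputable section

set_option linter.dupNamespace false

namespace Summit.HodgeConjecture.HodgeConjecture.Ring2.AbelianAll

open CategoryTheory CategoryTheory.Limits AlgebraicGeometry MonoidalCategory CartesianMonoidalCategory
open Literature.AlgebraicGeometry Literature.AlgebraicGeometry.Motives
open Literature.AlgebraicGeometry.HodgeTheory Literature.AlgebraicGeometry.VanGeemen1994
open Literature.AlgebraicTopology.SingularHomology (singularCohomology)
open Summit.HodgeConjecture.CorCM.Model

/-! ## §1 Odd `dim T`: the weight-`m` polarized twisted square is hyperbolic iff `m` is a norm -/

section Dichotomy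

variable {T : AbelianVariety ℂ} {k d : ℕ} {φ : T ⟶ T}

/-- **THE DICHOTOMY AT THE ODD ANCHORS** (`dim T = 2k + 1 ≥ 3`, `φ² = −d`, `d ≥ 1`): ONE projective embedding `e_T` of `T` and, for every weight `m ≥ 1`,
a projective embedding of `T × T` with `K`-symmetrised class `pr₁^*h_K + m·pr₂^*h_K` carrying a non-degenerate van Geemen witness of class `[−m]`
(part O-a/O-b), for which **`(T × T, φ × (−φ))` is HYPERBOLIC if and only if `m ∈ Nm(K_dˣ)`**: ⟸ `[−m] = [−1] = [(−1)^{2k+1}]` and Landherr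
(part P-a §1); ⟹ a hyperbolic class has `det H = [(−1)ⁿ]` (van Geemen (5.4.1)) and the class is unique, so `[−m] = [−1]`, i.e. `m ∈ Nm(K_dˣ)`.
Markman's «if and only if» (§11.5 Step 1) at the anchors, on the carriers. [cite: vanGeemen1994HodgeAV, 4.14, Lemma 5.2 (3), 5.4 and (5.4.1)]
[cite: Landherr1936HermitianForms] [cite: Markman2025SurveySecant, §11.5 Step 1] -/
theorem twistedSquare_hyperbolic_iff_mem_norm_of_odd (hk : 1 ≤ k) (hT : T.dim = 2 * k + 1) (hd : 0 < d) (hφ : φ ≫ φ = -(d • 𝟙 T)) :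
    ∃ (eT : ProjectiveEmbedding T.X) (aT : complexBetti (projectiveSpace eT.n ℂ) 2),
      IsRationalClass aT ∧ aT ≠ 0 ∧
      ∀ (m : ℕ) (hm : 0 < m),
        ∃ (e : ProjectiveEmbedding (T.prod T).X) (a : complexBetti (projectiveSpace e.n ℂ) 2),
          IsRationalClass a ∧ a ≠ 0 ∧
          (d : ℂ) • complexBetti.map e.ι 2 a +
              complexBetti.map (AbelianVariety.prodLift (AbelianVariety.fst T T ≫ φ)
                (AbelianVariety.snd T T ≫ (-φ))).hom.hom.hom 2 (complexBetti.map e.ι 2 a) =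
            complexBetti.map (AbelianVariety.fst T T).hom.hom.hom 2
                ((d : ℂ) • complexBetti.map eT.ι 2 aT + complexBetti.map φ.hom.hom.hom 2 (complexBetti.map eT.ι 2 aT)) +
              ((m : ℚ) : ℂ) • complexBetti.map (AbelianVariety.snd T T).hom.hom.hom 2
                ((d : ℂ) • complexBetti.map eT.ι 2 aT + complexBetti.map φ.hom.hom.hom 2 (complexBetti.map eT.ι 2 aT)) ∧
          HasWeilDiscriminantNondeg (T.prod T)
            (AbelianVariety.prodLift (AbelianVariety.fst T T ≫ φ) (AbelianVariety.snd T T ≫ (-φ))) (2 * k + 1) d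
            ((d : ℂ) • complexBetti.map e.ι 2 a +
              complexBetti.map (AbelianVariety.prodLift (AbelianVariety.fst T T ≫ φ)
                (AbelianVariety.snd T T ≫ (-φ))).hom.hom.hom 2 (complexBetti.map e.ι 2 a))
            (QuotientGroup.mk (-Units.mk0 (m : ℚ) (Nat.cast_ne_zero.2 hm.ne'))) ∧
          (IsHyperbolicWeilType (T.prod T)
              (AbelianVariety.prodLift (AbelianVariety.fst T T ≫ φ) (AbelianVariety.snd T T ≫ (-φ))) (2 * k + 1)
              ((d : ℂ) • complexBetti.map e.ι 2 a +
                complexBetti.map (AbelianVariety.prodLift (AbelianVariety.fst T T ≫ φ)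
                  (AbelianVariety.snd T T ≫ (-φ))).hom.hom.hom 2 (complexBetti.map e.ι 2 a)) ↔
            Units.mk0 (m : ℚ) (Nat.cast_ne_zero.2 hm.ne') ∈ normUnitsSubgroup ℚ (weilField d)) := by
  have hW : IsWeilType (T.prod T)
      (AbelianVariety.prodLift (AbelianVariety.fst T T ≫ φ) (AbelianVariety.snd T T ≫ (-φ))) (2 * k + 1) d :=
    isWeilType_twistedSquare (by omega) hT hd hφ
  obtain ⟨eT, aT, haT, haT0, hall⟩ := exists_nonsplit_polarized_twistedSquare_of_odd hk hT hd hφ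
  refine ⟨eT, aT, haT, haT0, fun m hm ↦ ?_⟩
  obtain ⟨e, a, ha, ha0, hh, hδ, hnot⟩ := hall m hm
  refine ⟨e, a, ha, ha0, hh, hδ, ⟨fun hhyp ↦ ?_, fun hnorm ↦ ?_⟩⟩
  · -- ⟹ : contrapositive of part O-b
    by_contra hnorm
    exact hnot hnorm hhyp
  · -- ⟸ : `[−m] = [−1] = [(−1)^{2k+1}]`, Landherr
    have h1 : (QuotientGroup.mk (-Units.mk0 (m : ℚ) (Nat.cast_ne_zero.2 hm.ne')) : weilNormResidueGroup d) =
        QuotientGroup.mk ((-1 : ℚˣ) ^ (2 * k + 1)) := by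
      rw [Odd.neg_one_pow ⟨k, rfl⟩, ← neg_one_mul (Units.mk0 (m : ℚ) _), QuotientGroup.mk_mul,
        (QuotientGroup.eq_one_iff _).2 hnorm, mul_one]
    rw [h1] at hδ
    exact isHyperbolicWeilType_of_isWeilType_of_hasWeilDiscriminantNondeg_neg_one_pow hW e ha ha0 hδ

end Dichotomy

/-! ## §2 The pencils through an odd anchor: split everywhere or non-split everywhere, by the weight -/

section Pencils

variable {𝒳 S : SchemeOver ℂ} {f : 𝒳 ⟶ S}

/-- **THE DICHOTOMY ALONG THE PENCIL** (fact-free). Compact abelian pencil with a global endomorphism `Φ` over `S`, `K`-compatible charts `(A_s, e_s, φ_s)`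
(`φ_s² = −d_K`, `d_K ≥ 1`), a projective embedding `E` of `𝒳` with a rational ambient `a ≠ 0` (`H_K = d_K·E^*a + Φ^*E^*a`), a global `U₊` with
`e_t^*(U₊|X_t) ∈ E₊`, `U₊|X_t ≠ 0`; the chart at `t` `K`-isogenous (`gT`) to `(T × T, φ_T × (−φ_T))` with `dim T = 2k + 1`, and `e_t^*(H_K|X_t) = gT^*h` for a
class `h` on `T × T` with a non-degenerate witness of class `[−m]` (`m ≥ 1`; §1 / part O-a: the weight-`m` product class). THEN: if `m ∈ Nm(K_dˣ)`, EVERY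
member `(A_s, φ_s)` is of Weil type and HYPERBOLIC for `e_s^*(H_K|X_s)` (part P-d §2: `[−m] = [(−1)^{2k+1}]`); if `m ∉ Nm(K_dˣ)`, NO member is hyperbolic for
it (part O-c §2: the class `[−m] ≠ [−1]` is transported). Through the SAME anchor the weight decides: split pencils (closed modulo refereed print for
`k = 1`, `d_K ∈ {1, 3}`, part P-d §3) or the open instance (part O-c §4). [cite: vanGeemen1994HodgeAV, 4.14, Lemma 5.2 (3), 5.4 and (5.4.1)]
[cite: Landherr1936HermitianForms] [cite: Andre1996Motifs, §6.3 Lemme 6.3.3 and Remarque 2 (p. 33)] -/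
theorem weilPencil_dichotomy_of_oddTwistedSquareChart {k dK : ℕ} (hdK : 0 < dK) {dX : ℕ} (hf : IsCompactAbelianPencil f dX)
    (Φ : 𝒳 ⟶ 𝒳) (hΦ : Φ ≫ f = f)
    (A : ComplexPoints S → AbelianVariety ℂ) (e : ∀ s, (A s).X ≅ fiberOver f s) (φ : ∀ s, A s ⟶ A s)
    (hφ : ∀ s, φ s ≫ φ s = -(dK • 𝟙 (A s)))
    (hK : ∀ s, ∃ Φs : fiberOver f s ⟶ fiberOver f s, Φs ≫ fiberι f s = fiberι f s ≫ Φ ∧ (e s).hom ≫ Φs = (φ s).hom.hom.hom ≫ (e s).hom)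
    (E : ProjectiveEmbedding 𝒳) {a : complexBetti (projectiveSpace E.n ℂ) 2} (ha : IsRationalClass a) (ha0 : a ≠ 0)
    (Up : complexBetti 𝒳 (2 * (2 * k + 1))) {t : ComplexPoints S}
    (hUpt : complexBetti.map (e t).hom (2 * (2 * k + 1)) (complexBetti.map (fiberι f t) (2 * (2 * k + 1)) Up) ∈
      weilClassesPlus (A t) (φ t) (2 * k + 1) dK)
    (hUp0 : complexBetti.map (fiberι f t) (2 * (2 * k + 1)) Up ≠ 0)
    {T : AbelianVariety ℂ} {φT : T ⟶ T} (hT : T.dim = 2 * k + 1) (hφT : φT ≫ φT = -(dK • 𝟙 T))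
    (gT : A t ⟶ T.prod T) (hγ : AbelianVariety.IsIsogeny gT)
    (hcomm : gT ≫ AbelianVariety.prodLift (AbelianVariety.fst T T ≫ φT) (AbelianVariety.snd T T ≫ (-φT)) = φ t ≫ gT)
    {h : complexBetti (T.prod T).X 2} {m : ℕ} (hm : 0 < m)
    (hδ : HasWeilDiscriminantNondeg (T.prod T)
      (AbelianVariety.prodLift (AbelianVariety.fst T T ≫ φT) (AbelianVariety.snd T T ≫ (-φT))) (2 * k + 1) dK h
      (QuotientGroup.mk (-Units.mk0 (m : ℚ) (Nat.cast_ne_zero.2 hm.ne'))))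
    (hH : complexBetti.map (e t).hom 2 (complexBetti.map (fiberι f t) 2
      ((dK : ℂ) • complexBetti.map E.ι 2 a + complexBetti.map Φ 2 (complexBetti.map E.ι 2 a))) = complexBetti.map gT.hom.hom.hom 2 h) :
    (Units.mk0 (m : ℚ) (Nat.cast_ne_zero.2 hm.ne') ∈ normUnitsSubgroup ℚ (weilField dK) →
        ∀ s : ComplexPoints S,
          IsWeilType (A s) (φ s) (2 * k + 1) dK ∧
            IsHyperbolicWeilType (A s) (φ s) (2 * k + 1) (complexBetti.map (e s).hom 2 (complexBetti.map (fiberι f s) 2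
              ((dK : ℂ) • complexBetti.map E.ι 2 a + complexBetti.map Φ 2 (complexBetti.map E.ι 2 a))))) ∧
      (Units.mk0 (m : ℚ) (Nat.cast_ne_zero.2 hm.ne') ∉ normUnitsSubgroup ℚ (weilField dK) →
        ∀ s : ComplexPoints S,
          ¬ IsHyperbolicWeilType (A s) (φ s) (2 * k + 1) (complexBetti.map (e s).hom 2 (complexBetti.map (fiberι f s) 2
              ((dK : ℂ) • complexBetti.map E.ι 2 a + complexBetti.map Φ 2 (complexBetti.map E.ι 2 a))))) := by
  refine ⟨fun hnorm s ↦ ?_, fun hnorm s ↦ ?_⟩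
  · -- `m ∈ Nm`: the class is the split class; part P-d §2
    have h1 : (QuotientGroup.mk (-Units.mk0 (m : ℚ) (Nat.cast_ne_zero.2 hm.ne')) : weilNormResidueGroup dK) =
        QuotientGroup.mk ((-1 : ℚˣ) ^ (2 * k + 1)) := by
      rw [Odd.neg_one_pow ⟨k, rfl⟩, ← neg_one_mul (Units.mk0 (m : ℚ) _), QuotientGroup.mk_mul,
        (QuotientGroup.eq_one_iff _).2 hnorm, mul_one]
    rw [h1] at hδ
    obtain ⟨hWs, -, hhyps⟩ := hyperbolic_weilPencil_of_twistedSquareChart_of_splitClass (q := 2 * k) hdK hf Φ hΦ A e φ hφ hK E ha ha0 Up hUpt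
      hUp0 hT hφT gT hγ hcomm hδ hH s
    exact ⟨hWs, hhyps⟩
  · -- `m ∉ Nm`: the class `[−m] ≠ [−1]` is transported; part O-c §2
    have hWt : IsWeilType (A t) (φ t) (2 * k + 1) dK := isWeilType_of_isogeny_twistedSquare (by omega) hT hdK hφT (hφ t) gT hγ hcomm
    have hδt : HasWeilDiscriminantNondeg (A t) (φ t) (2 * k + 1) dK (complexBetti.map (e t).hom 2 (complexBetti.map (fiberι f t) 2
        ((dK : ℂ) • complexBetti.map E.ι 2 a + complexBetti.map Φ 2 (complexBetti.map E.ι 2 a))))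
        (QuotientGroup.mk (-Units.mk0 (m : ℚ) (Nat.cast_ne_zero.2 hm.ne'))) := by
      rw [hH]; exact hasWeilDiscriminantNondeg_of_isogeny_twistedSquare gT hγ hcomm hδ
    have hne : (QuotientGroup.mk (-Units.mk0 (m : ℚ) (Nat.cast_ne_zero.2 hm.ne')) : weilNormResidueGroup dK) ≠
        QuotientGroup.mk ((-1 : ℚˣ) ^ (2 * k + 1)) := by
      rw [Odd.neg_one_pow ⟨k, rfl⟩]
      exact (weilNormResidueGroup_mk_neg_ne_mk_neg_one_iff _).2 hnorm
    exact (not_isHyperbolicWeilType_member_of_member hf (n := 2 * k + 1) (by omega) hdK Φ hΦ A e φ hφ hK E ha ha0 hWt.dim_eq hδt hne s).2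

end Pencils

end Summit.HodgeConjecture.HodgeConjecture.Ring2.AbelianAll

end
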